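import Literature.NumberTheory.Irrationality.Dupont2018.CubeIntegralSeries
import Literature.NumberTheory.Irrationality.CressonFischlerRivoal2008.WellPoisedSymmetry
import HarnessLib

/-!
# Dupont, *Odd zeta motive and linear forms in odd zeta values*, Corollary 5.6 — PROVED

[cite: Dupont2018OddZeta, Corollary 5.6]: for `n ≥ 1`, `N ≥ 0`, `uᵢ, vᵢ ≥ 1` with `Σvᵢ ≥ N + 1`, the cube
integral `∫_{[0,1]ⁿ} ∏ᵢ xᵢ^{uᵢ−1}(1−xᵢ)^{vᵢ−1}/(1−x₁⋯xₙ)^N dx` converges absolutely and evaluates to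
`a₀ + a₂ζ(2) + ⋯ + a_nζ(n)` with rational `a_k`; in the balanced case `2uᵢ + vᵢ = N + 1` the `a_k` of the
parity of `(n+1)(N+1)` vanish.  This file discharges the named fact
`Literature.NumberTheory.Irrationality.Dupont2018.corollary_5_6` (`corollary_5_6_holds`).

## Route (deviation from the printed proof, stated once)

Dupont's proof is motivic (Theorem 5.4: the integrand lives on the odd zeta motive).  We follow instead the
classical hypergeometric road which the source itself names as the origin of these integrals
([Dupont2018OddZeta, §1.1 and §5.2]: "the Ball–Rivoal integrals"; [Rivoal2000CRAS, Lemme 1–2];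
[CressonFischlerRivoal2008, Théorème 1]):
1. (`CubeIntegralSeries`) the integral is the series `Σ_{m≥0} C(N+m−1,m)∏ᵢ(uᵢ+m−1)!(vᵢ−1)!/(uᵢ+vᵢ+m−1)!`;
2. (here) for `N ≥ 1` its general term is `Q(m)/((m+1)⋯(m+L+1))ⁿ` for an explicit polynomial
   `Q = windowPoly` of degree `≤ nL + n − 2` exactly when `Σvᵢ ≥ N+1`, so the partial-fraction machinery of
   [CressonFischlerRivoal2008, §4] (`exists_partialFractions`, `partialFractions_sum_order_zero`,
   `hasSum_partialFractions`) sums it to `Σ_{2≤k≤n} a_kζ(k) + a₀`, `a_k ∈ ℚ`;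
3. (here) in the balanced case the window is `(m+1)⋯(m+N−1)` and `Q(−N−X) = (−1)^{N−1}Q(X)`
   (`windowPoly_reflect`), which is the hypothesis of [CressonFischlerRivoal2008, Théorème 1] with the sign
   `(−1)^{n(N−1)+1}` when `n, N` are even (odd zeta values only: `partialFractions_sum_odd_order`) and with the
   opposite sign otherwise (even zeta values only: `sum_pf_even_order`, the twin of the printed reflection
   argument [Rivoal2000CRAS, §2 proof of Lemme 1], proved here).
No new named facts.  HONEST FRAMING (pub-zeta5): a vendored classical evaluation; nothing here is an
irrationality statement.
-/

noncomputable section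

namespace Literature.NumberTheory.Irrationality.Dupont2018

open MeasureTheory Finset Polynomial
open scoped Nat
open Literature.NumberTheory.Transcendental (zetaValue)
open Literature.NumberTheory.Transcendental.BallRivoal (poch pochPoly pfEval harm eval_pochPoly poch_reflect
  poch_pos pf_unique pfEval_add pfEval_reflect)
open Literature.NumberTheory.Irrationality.CressonFischlerRivoal2008 (exists_partialFractions
  partialFractions_sum_order_zero partialFractions_sum_odd_order hasSum_partialFractions)

/-! ### The terms as rational numbers -/

/-- The `m`-th term of the series as a rational number. [cite: Rivoal2000CRAS, Lemme 2] -/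
def cubeTermQ (n N : ℕ) (u v : Fin n → ℕ) (m : ℕ) : ℚ :=
  ((N + m - 1).choose m : ℚ) * ∏ i, ((u i + m - 1)! : ℚ) * ((v i - 1)! : ℚ) / ((u i + v i + m - 1)! : ℚ)

/-- `cubeTermQ` casts to `cubeTerm`. [cite: Rivoal2000CRAS, Lemme 2] -/
theorem cubeTermQ_cast (n N : ℕ) (u v : Fin n → ℕ) (m : ℕ) :
    ((cubeTermQ n N u v m : ℚ) : ℝ) = cubeTerm n N u v m := by
  unfold cubeTermQ cubeTerm
  push_cast
  rfl

/-! ### Pochhammer bookkeeping -/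

/-- `(t)_{a+b} = (t)_a (t+a)_b` (the Summit-side `Zeta5Search.DualSeriesDenominators.poch_add` has the same
statement; Literature cannot import Summits). [cite: CressonFischlerRivoal2008, §1 (notation)] -/
theorem poch_add (t : ℚ) (a b : ℕ) : poch t (a + b) = poch t a * poch (t + a) b := by
  unfold poch
  rw [prod_range_add]
  refine congrArg₂ (· * ·) rfl (prod_congr rfl fun x _ => ?_)
  push_cast
  ring

/-- `(a+1)_k · a! = (a+k)!`. [cite: CressonFischlerRivoal2008, §1 (notation)] -/
theorem poch_succ_mul_factorial (a k : ℕ) :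
    poch ((a : ℚ) + 1) k * (a ! : ℚ) = ((a + k)! : ℚ) := by
  induction k with
  | zero => simp [poch]
  | succ k ih =>
    have h : poch ((a : ℚ) + 1) (k + 1) = poch ((a : ℚ) + 1) k * ((a : ℚ) + 1 + k) := by
      unfold poch
      rw [prod_range_succ]
    rw [h, mul_right_comm, ih, show a + (k + 1) = (a + k) + 1 by omega, Nat.factorial_succ (a + k)]
    push_cast
    ring

/-- One Beta factor in Pochhammer form: `(u+m−1)!(v−1)!/(u+v+m−1)! = (v−1)!/(m+u)_v` (`u ≥ 1`).
[cite: Rivoal2000CRAS, Lemme 2] -/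
theorem betaFactor_eq_poch {u : ℕ} (v m : ℕ) (hu : 1 ≤ u) :
    ((u + m - 1)! : ℚ) * ((v - 1)! : ℚ) / ((u + v + m - 1)! : ℚ) =
      ((v - 1)! : ℚ) / poch ((m : ℚ) + u) v := by
  obtain ⟨u', rfl⟩ : ∃ u', u = u' + 1 := ⟨u - 1, by omega⟩
  have h := poch_succ_mul_factorial (u' + m) v
  have e1 : u' + 1 + m - 1 = u' + m := by omega
  have e2 : u' + 1 + v + m - 1 = u' + m + v := by omega
  rw [e1, e2, ← h, show ((u' + m : ℕ) : ℚ) + 1 = (m : ℚ) + ((u' + 1 : ℕ) : ℚ) by push_cast; ring]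
  have hp : poch ((m : ℚ) + ((u' + 1 : ℕ) : ℚ)) v ≠ 0 := (poch_pos (by positivity) v).ne'
  have hf : ((u' + m)! : ℚ) ≠ 0 := by positivity
  field_simp

/-- The binomial factor in Pochhammer form: `C(N+m−1,m) = (m+1)_{N−1}/(N−1)!` (`N ≥ 1`).
[cite: Rivoal2000CRAS, Lemme 2] -/
theorem choose_eq_poch {N : ℕ} (m : ℕ) (hN : 1 ≤ N) :
    (((N + m - 1).choose m : ℕ) : ℚ) = poch ((m : ℚ) + 1) (N - 1) / ((N - 1)! : ℚ) := by
  obtain ⟨N', rfl⟩ : ∃ N', N = N' + 1 := ⟨N - 1, by omega⟩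
  have e1 : N' + 1 + m - 1 = m + N' := by omega
  have e2 : N' + 1 - 1 = N' := by omega
  rw [e1, e2, Nat.cast_choose ℚ (by omega : m ≤ m + N'), show m + N' - m = N' by omega,
    ← poch_succ_mul_factorial m N']
  have hf : ((m)! : ℚ) ≠ 0 := by positivity
  have hf' : ((N')! : ℚ) ≠ 0 := by positivity
  field_simp

/-! ### The window polynomial -/

/-- The numerator polynomial `Q` for the window `(m+1)⋯(m+L'+1)`:
`Q = (∏ᵢ(vᵢ−1)!/(N−1)!) · (X+1)_{N−1} · ∏ᵢ (X+1)_{uᵢ−1} (X+uᵢ+vᵢ)_{L'+2−uᵢ−vᵢ}`, so that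
`Q(m)/((m+1)_{L'+1})ⁿ = cubeTermQ m`. [cite: CressonFischlerRivoal2008, §4.1; Rivoal2000CRAS, Lemme 2] -/
def windowPoly (n N L' : ℕ) (u v : Fin n → ℕ) : ℚ[X] :=
  C ((∏ i, ((v i - 1)! : ℚ)) / ((N - 1)! : ℚ)) * pochPoly 1 (N - 1) *
    ∏ i, (pochPoly 1 (u i - 1) * pochPoly ((u i : ℚ) + v i) (L' + 2 - (u i + v i)))

/-- Evaluation of the window polynomial. [cite: CressonFischlerRivoal2008, §4.1] -/
theorem windowPoly_eval (n N L' : ℕ) (u v : Fin n → ℕ) (t : ℚ) :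
    (windowPoly n N L' u v).eval t =
      (∏ i, ((v i - 1)! : ℚ)) / ((N - 1)! : ℚ) * poch (t + 1) (N - 1) *
        ∏ i, (poch (t + 1) (u i - 1) * poch (t + ((u i : ℚ) + v i)) (L' + 2 - (u i + v i))) := by
  simp only [windowPoly, eval_mul, eval_C, eval_prod, eval_pochPoly]

/-- `deg (X+β)_k ≤ k` (same statement as the Summit-side `Zeta5Search.DualSeries.natDegree_pochPoly_le`;
Literature cannot import Summits). [cite: CressonFischlerRivoal2008, §4.1] -/
theorem natDegree_pochPoly_le (β : ℚ) (k : ℕ) : (pochPoly β k).natDegree ≤ k := by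
  unfold pochPoly
  refine (natDegree_prod_le _ _).trans ?_
  refine (sum_le_sum (g := fun _ => 1) fun s _ => ?_).trans (by simp)
  show (X + C (β + (s : ℚ))).natDegree ≤ 1
  exact (natDegree_X_add_C _).le

/-- The degree bound `deg Q ≤ (N−1) + Σᵢ ((uᵢ−1) + (L'+2−uᵢ−vᵢ))`. [cite: CressonFischlerRivoal2008, §4.1] -/
theorem natDegree_windowPoly_le (n N L' : ℕ) (u v : Fin n → ℕ) :
    (windowPoly n N L' u v).natDegree ≤ (N - 1) + ∑ i, ((u i - 1) + (L' + 2 - (u i + v i))) := by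
  unfold windowPoly
  refine (natDegree_mul_le).trans (Nat.add_le_add ((natDegree_mul_le).trans ?_) ?_)
  · rw [natDegree_C, zero_add]; exact natDegree_pochPoly_le _ _
  · refine (natDegree_prod_le _ _).trans (sum_le_sum fun i _ => ?_)
    exact (natDegree_mul_le).trans (Nat.add_le_add (natDegree_pochPoly_le _ _) (natDegree_pochPoly_le _ _))

/-- The window splits as `(t+1)_{L'+1} = (t+1)_{u−1} (t+u)_v (t+u+v)_{L'+2−u−v}` when `1 ≤ u`, `u+v ≤ L'+2`.
[cite: CressonFischlerRivoal2008, §4.1] -/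
theorem poch_window_split (t : ℚ) {u v L' : ℕ} (hu : 1 ≤ u) (hL : u + v ≤ L' + 2) :
    poch (t + 1) (L' + 1) =
      poch (t + 1) (u - 1) * poch (t + u) v * poch (t + ((u : ℚ) + v)) (L' + 2 - (u + v)) := by
  have e : L' + 1 = (u - 1) + (v + (L' + 2 - (u + v))) := by omega
  rw [e, poch_add, poch_add]
  have e1 : t + 1 + ((u - 1 : ℕ) : ℚ) = t + u := by
    rw [Nat.cast_sub hu]; push_cast; ring
  have e2 : t + (u : ℚ) + (v : ℚ) = t + ((u : ℚ) + v) := by ring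
  rw [e1, e2, mul_assoc]

/-- `Q(m)/((m+1)_{L'+1})ⁿ = cubeTermQ m` for `N ≥ 1`, `uᵢ, vᵢ ≥ 1`, `uᵢ + vᵢ ≤ L' + 2`.
[cite: CressonFischlerRivoal2008, §4.1; Rivoal2000CRAS, Lemme 2] -/
theorem windowPoly_div_eq {n N L' : ℕ} {u v : Fin n → ℕ} (hN : 1 ≤ N) (hu : ∀ i, 1 ≤ u i)
    (hL : ∀ i, u i + v i ≤ L' + 2) (m : ℕ) :
    (windowPoly n N L' u v).eval (m : ℚ) / poch ((m : ℚ) + 1) (L' + 1) ^ n = cubeTermQ n N u v m := by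
  rw [windowPoly_eval, cubeTermQ, choose_eq_poch m hN]
  have hW : poch ((m : ℚ) + 1) (L' + 1) ^ n = ∏ _i : Fin n, poch ((m : ℚ) + 1) (L' + 1) := by
    rw [prod_const, card_univ, Fintype.card_fin]
  rw [hW, mul_div_assoc, ← prod_div_distrib]
  have hfac : ∀ i, poch ((m : ℚ) + 1) (u i - 1) * poch ((m : ℚ) + ((u i : ℚ) + v i)) (L' + 2 - (u i + v i)) /
      poch ((m : ℚ) + 1) (L' + 1) = 1 / poch ((m : ℚ) + u i) (v i) := by
    intro i
    rw [poch_window_split (m : ℚ) (hu i) (hL i)]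
    have h1 : poch ((m : ℚ) + 1) (u i - 1) ≠ 0 := (poch_pos (by positivity) _).ne'
    have h2 : poch ((m : ℚ) + u i) (v i) ≠ 0 := (poch_pos (by have := hu i; positivity) _).ne'
    have h3 : poch ((m : ℚ) + ((u i : ℚ) + v i)) (L' + 2 - (u i + v i)) ≠ 0 :=
      (poch_pos (by have := hu i; positivity) _).ne'
    field_simp
  rw [prod_congr rfl fun i _ => hfac i, prod_congr rfl fun i _ => betaFactor_eq_poch (v i) m (hu i)]
  rw [prod_div_distrib, prod_div_distrib]
  simp only [prod_const_one]
  ring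


/-! ### Partial fractions and the value of the series -/

/-- The degree hypothesis of the partial-fraction machinery, `deg Q + 2 ≤ n(L'+1)`, follows from `Σvᵢ ≥ N+1`.
[cite: CressonFischlerRivoal2008, §4.4 (first display, `deg P ≤ A(n+1) − 2`)] -/
theorem natDegree_windowPoly_add_two_le {n N L' : ℕ} {u v : Fin n → ℕ} (hN : 1 ≤ N) (hu : ∀ i, 1 ≤ u i)
    (hL : ∀ i, u i + v i ≤ L' + 2) (hV : N + 1 ≤ ∑ i, v i) :
    (windowPoly n N L' u v).natDegree + 2 ≤ n * (L' + 1) := by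
  have h := natDegree_windowPoly_le n N L' u v
  have hsum : ∑ i, ((u i - 1) + (L' + 2 - (u i + v i))) + ∑ i, v i = n * (L' + 1) := by
    rw [← sum_add_distrib, ← show ∑ _i : Fin n, (L' + 1) = n * (L' + 1) by simp]
    exact sum_congr rfl fun i _ => by have := hu i; have := hL i; omega
  omega

/-- Partial-fraction data of `Q(t)/((t+1)_{L'+1})ⁿ` exist. [cite: CressonFischlerRivoal2008, §4.1] -/
theorem exists_pfData {n N L' : ℕ} {u v : Fin n → ℕ} (hn : 1 ≤ n) (hN : 1 ≤ N) (hu : ∀ i, 1 ≤ u i)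
    (hL : ∀ i, u i + v i ≤ L' + 2) (hV : N + 1 ≤ ∑ i, v i) :
    ∃ c : ℕ → ℕ → ℚ, ∀ t : ℚ, (∀ p, p ≤ L' → t + p + 1 ≠ 0) →
      pfEval L' n c t = (windowPoly n N L' u v).eval t / poch (t + 1) (L' + 1) ^ n := by
  refine exists_partialFractions L' n hn _ (degree_le_natDegree.trans_lt ?_)
  have h := natDegree_windowPoly_add_two_le hN hu hL hV
  exact_mod_cast (show (windowPoly n N L' u v).natDegree < n * (L' + 1) by omega)

/-- **The series summed by partial fractions.** For `N ≥ 1` and a window containing all the Beta factors,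
the cube integral is `Σ_{1≤o<n}(Σ_p c_{o,p})ζ(o+1) − Σ_{o<n}Σ_p c_{o,p}H_p^{(o+1)}` for any partial-fraction
data `c` of `Q(t)/((t+1)_{L'+1})ⁿ`. [cite: CressonFischlerRivoal2008, §4.4; Rivoal2000CRAS, §2 Lemme 1] -/
theorem cubeIntegral_eq_pfSum {n N L' : ℕ} {u v : Fin n → ℕ} (hn : 1 ≤ n) (hN : 1 ≤ N)
    (hu : ∀ i, 1 ≤ u i) (hv : ∀ i, 1 ≤ v i) (hL : ∀ i, u i + v i ≤ L' + 2) (hV : N + 1 ≤ ∑ i, v i)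
    (c : ℕ → ℕ → ℚ)
    (hc : ∀ t : ℚ, (∀ p, p ≤ L' → t + p + 1 ≠ 0) →
      pfEval L' n c t = (windowPoly n N L' u v).eval t / poch (t + 1) (L' + 1) ^ n) :
    cubeIntegral n N u v =
      ∑ o ∈ Ico 1 n, (∑ p ∈ range (L' + 1), (c o p : ℝ)) * zetaValue (o + 1) -
        ∑ o ∈ range n, ∑ p ∈ range (L' + 1), (c o p : ℝ) * (harm (o + 1) p : ℝ) := by
  have hz := partialFractions_sum_order_zero L' n hn _ (natDegree_windowPoly_add_two_le hN hu hL hV) c hc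
  have hS := hasSum_partialFractions L' n hn c
    (fun t => (windowPoly n N L' u v).eval t / poch (t + 1) (L' + 1) ^ n) hc hz
  have hF : (fun k : ℕ => (((fun t : ℚ => (windowPoly n N L' u v).eval t / poch (t + 1) (L' + 1) ^ n)
      (k : ℚ) : ℚ) : ℝ)) = cubeTerm n N u v := by
    funext k
    simp only []
    rw [windowPoly_div_eq hN hu hL k, cubeTermQ_cast]
  rw [hF] at hS
  exact (hasSum_cubeIntegral hn hu hv hV).unique hS

/-- The rational coefficients read off partial-fraction data: `a₀ = −Σ_{o<n}Σ_p c_{o,p}H_p^{(o+1)}`,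
`a_k = Σ_p c_{k−1,p}` (`k ≥ 1`). [cite: CressonFischlerRivoal2008, §4.4] -/
def pfCoeff (n L' : ℕ) (c : ℕ → ℕ → ℚ) (k : ℕ) : ℚ :=
  if k = 0 then -∑ o ∈ range n, ∑ p ∈ range (L' + 1), c o p * harm (o + 1) p
  else ∑ p ∈ range (L' + 1), c (k - 1) p

/-- Re-indexing the partial-fraction sum as `a₀ + Σ_{2≤k≤n} a_kζ(k)`. [cite: CressonFischlerRivoal2008, §4.4] -/
theorem pfSum_eq_coeffForm (n L' : ℕ) (c : ℕ → ℕ → ℚ) :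
    ∑ o ∈ Ico 1 n, (∑ p ∈ range (L' + 1), (c o p : ℝ)) * zetaValue (o + 1) -
        ∑ o ∈ range n, ∑ p ∈ range (L' + 1), (c o p : ℝ) * (harm (o + 1) p : ℝ) =
      (pfCoeff n L' c 0 : ℝ) + ∑ k ∈ Icc 2 n, (pfCoeff n L' c k : ℝ) * zetaValue k := by
  have h2 : ∀ o, (pfCoeff n L' c (o + 1) : ℝ) = ∑ p ∈ range (L' + 1), (c o p : ℝ) := by
    intro o
    rw [pfCoeff, if_neg (Nat.succ_ne_zero o), Nat.add_sub_cancel]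
    push_cast
    rfl
  have h1 : ∑ k ∈ Icc 2 n, (pfCoeff n L' c k : ℝ) * zetaValue k =
      ∑ o ∈ Ico 1 n, (∑ p ∈ range (L' + 1), (c o p : ℝ)) * zetaValue (o + 1) := by
    rw [← Finset.Ico_add_one_right_eq_Icc, ← map_add_right_Ico 1 n 1, sum_map]
    exact sum_congr rfl fun o _ => by rw [← h2 o]; rfl
  rw [h1, pfCoeff, if_pos rfl]
  push_cast
  ring

/-- The decomposition for `N ≥ 1`: `∃ a : ℕ → ℚ`, integral `= a₀ + Σ_{2≤k≤n} a_kζ(k)`.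
[cite: Dupont2018OddZeta, Corollary 5.6 (first claim); CressonFischlerRivoal2008, §4.4] -/
theorem exists_coeffs_of_pos {n N : ℕ} {u v : Fin n → ℕ} (hn : 1 ≤ n) (hN : 1 ≤ N)
    (hu : ∀ i, 1 ≤ u i) (hv : ∀ i, 1 ≤ v i) (hV : N + 1 ≤ ∑ i, v i) :
    ∃ a : ℕ → ℚ, cubeIntegral n N u v = a 0 + ∑ k ∈ Icc 2 n, (a k : ℝ) * zetaValue k := by
  have hL : ∀ i, u i + v i ≤ (∑ j, (u j + v j)) + 2 := fun i =>
    (single_le_sum (f := fun j => u j + v j) (fun j _ => Nat.zero_le _) (mem_univ i)).trans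
      (Nat.le_add_right _ _)
  obtain ⟨c, hc⟩ := exists_pfData hn hN hu hL hV
  exact ⟨pfCoeff n _ c, by rw [cubeIntegral_eq_pfSum hn hN hu hv hL hV c hc, pfSum_eq_coeffForm]⟩

/-- The level `N = 0`: the integral is the rational number `∏ᵢ B(uᵢ, vᵢ)`.
[cite: Dupont2018OddZeta, Corollary 5.6 (first claim, `N = 0`)] -/
theorem cubeIntegral_level_zero {n : ℕ} {u v : Fin n → ℕ} (hn : 1 ≤ n) (hu : ∀ i, 1 ≤ u i)
    (hv : ∀ i, 1 ≤ v i) (hV : 0 + 1 ≤ ∑ i, v i) :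
    cubeIntegral n 0 u v = (cubeTermQ n 0 u v 0 : ℝ) := by
  have hS := hasSum_cubeIntegral (N := 0) hn hu hv hV
  have h0 : ∀ m, m ≠ 0 → cubeTerm n 0 u v m = 0 := fun m hm => by
    rw [cubeTerm, Nat.choose_eq_zero_of_lt (by omega)]; simp
  rw [hS.unique (hasSum_single 0 h0), cubeTermQ_cast]

/-! ### The balanced case: the reflection symmetry and the parity of the coefficients -/

/-- In the balanced case `2uᵢ + vᵢ = N + 1` (`N ≥ 2`, window `(m+1)⋯(m+N−1)`):
`Q(−N−t) = (−1)^{N−1} Q(t)`. [cite: Rivoal2000CRAS, §2 (the symmetry `R(−n−t) = −R(t)`);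
Dupont2018OddZeta, Corollary 5.6 (second claim)] -/
theorem windowPoly_reflect {n N : ℕ} {u v : Fin n → ℕ} (hN : 2 ≤ N) (hu : ∀ i, 1 ≤ u i)
    (hbal : ∀ i, 2 * u i + v i = N + 1) (t : ℚ) :
    (windowPoly n N (N - 2) u v).eval (-(N : ℚ) - t) =
      (-1) ^ (N - 1) * (windowPoly n N (N - 2) u v).eval t := by
  rw [windowPoly_eval, windowPoly_eval]
  have hB : poch (-(N : ℚ) - t + 1) (N - 1) = (-1) ^ (N - 1) * poch (t + 1) (N - 1) := by
    have h := poch_reflect (t + 1) (N - 1)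
    rw [show -(t + 1) - ((N - 1 : ℕ) : ℚ) + 1 = -(N : ℚ) - t + 1 by
      rw [Nat.cast_sub (by omega : 1 ≤ N)]; push_cast; ring] at h
    exact h
  have hF : ∀ i, poch (-(N : ℚ) - t + 1) (u i - 1) *
      poch (-(N : ℚ) - t + ((u i : ℚ) + v i)) (N - 2 + 2 - (u i + v i)) =
      poch (t + 1) (u i - 1) * poch (t + ((u i : ℚ) + v i)) (N - 2 + 2 - (u i + v i)) := by
    intro i
    have hu' := hu i
    have hb := hbal i
    have hcast : ((u i : ℚ) + v i) + u i = N + 1 := by exact_mod_cast (by omega : u i + v i + u i = N + 1)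
    rw [show N - 2 + 2 - (u i + v i) = u i - 1 by omega]
    have h1 := poch_reflect (t + ((u i : ℚ) + v i)) (u i - 1)
    rw [show -(t + ((u i : ℚ) + v i)) - ((u i - 1 : ℕ) : ℚ) + 1 = -(N : ℚ) - t + 1 by
      rw [Nat.cast_sub hu']; push_cast; linarith] at h1
    have h2 := poch_reflect (t + 1) (u i - 1)
    rw [show -(t + 1) - ((u i - 1 : ℕ) : ℚ) + 1 = -(N : ℚ) - t + ((u i : ℚ) + v i) by
      rw [Nat.cast_sub hu']; push_cast; linarith] at h2
    rw [h1, h2]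
    have hsq : ((-1 : ℚ) ^ (u i - 1)) * (-1) ^ (u i - 1) = 1 := by
      rw [← mul_pow, neg_one_mul, neg_neg, one_pow]
    linear_combination (poch (t + ((u i : ℚ) + v i)) (u i - 1) * poch (t + 1) (u i - 1)) * hsq
  rw [hB, prod_congr rfl fun i _ => hF i]
  ring

/-- The twin of the printed reflection argument, with the opposite sign: if
`P(−n'−X) = (−1)^{A(n'+1)}P(X)` then the partial-fraction data of `P(t+1)/((t+1)_{n'+1})^A` satisfy
`Σ_p c_{o,p} = 0` for every EVEN `o < A` — the odd zeta values drop out.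
[cite: Rivoal2000CRAS, §2 proof of Lemme 1; CressonFischlerRivoal2008, §4.4] -/
theorem sum_pf_even_order (n' A : ℕ) (P : ℚ[X])
    (hsym : P.comp (-(n' : ℚ[X]) - X) = (-1 : ℚ[X]) ^ (A * (n' + 1)) * P) (c : ℕ → ℕ → ℚ)
    (hc : ∀ t : ℚ, (∀ p, p ≤ n' → t + p + 1 ≠ 0) →
      pfEval n' A c t = (P.comp (X + C 1)).eval t / poch (t + 1) (n' + 1) ^ A)
    (o : ℕ) (ho : o < A) (hev : Even o) : ∑ p ∈ range (n' + 1), c o p = 0 := by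
  have hF : ∀ t : ℚ, (P.comp (X + C 1)).eval (-t - n' - 2) / poch (-t - n' - 2 + 1) (n' + 1) ^ A =
      (P.comp (X + C 1)).eval t / poch (t + 1) (n' + 1) ^ A := by
    intro t
    have h1 : (P.comp (X + C 1)).eval (-t - n' - 2) =
        (-1) ^ (A * (n' + 1)) * (P.comp (X + C 1)).eval t := by
      have h := congrArg (fun F : ℚ[X] => F.eval (t + 1)) hsym
      simp only [eval_comp, eval_sub, eval_neg, eval_natCast, eval_X, eval_mul, eval_pow, eval_one,
        eval_add, eval_C] at h ⊢
      rw [show -t - (n' : ℚ) - 2 + 1 = -(n' : ℚ) - (t + 1) by ring, h]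
    have h2 : poch (-t - n' - 2 + 1) (n' + 1) = (-1) ^ (n' + 1) * poch (t + 1) (n' + 1) := by
      have h := poch_reflect (t + 1) (n' + 1)
      push_cast at h
      rw [show -t - (n' : ℚ) - 2 + 1 = -(t + 1) - (n' + 1) + 1 by ring, h]
    rw [h1, h2, mul_pow, ← pow_mul, mul_comm (n' + 1) A,
      mul_div_mul_left _ _ (pow_ne_zero _ (by norm_num : (-1 : ℚ) ≠ 0))]
  have hneg : ∀ s : ℚ, pfEval n' A (fun o p => -c o p) s = -pfEval n' A c s := by
    intro s
    simp only [pfEval, neg_div, sum_neg_distrib]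
  set e : ℕ → ℕ → ℚ := (fun o p => (-1) ^ (o + 1) * c o (n' - p)) + fun o p => -c o p with he
  have hev0 : ∀ t : ℕ, 0 ≤ t → pfEval n' A e t = 0 := by
    intro t _
    have h1 : ∀ m, m ≤ n' → (t : ℚ) + m + 1 ≠ 0 := fun m _ => by positivity
    have h2 : ∀ m, m ≤ n' → (-(t : ℚ) - n' - 2) + m + 1 ≠ 0 := by
      intro m hm h0
      have : (m : ℚ) ≤ n' := by exact_mod_cast hm
      have ht0 : (0 : ℚ) ≤ t := by positivity
      linarith
    rw [he, pfEval_add, pfEval_reflect, hneg, hc _ h2, hc _ h1, hF]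
    ring
  have hsymm : ∀ p, p ≤ n' → c o (n' - p) = -c o p := by
    intro p hp
    have h := pf_unique n' A e 0 hev0 o p ho hp
    rw [he, Pi.add_apply, Pi.add_apply, hev.add_one.neg_one_pow] at h
    linarith
  have hrefl : ∑ p ∈ range (n' + 1), c o p = ∑ p ∈ range (n' + 1), c o (n' - p) := by
    conv_lhs => rw [← sum_range_reflect]
    refine sum_congr rfl fun p _ => ?_
    simp
  have hneg' : ∑ p ∈ range (n' + 1), c o (n' - p) = -∑ p ∈ range (n' + 1), c o p := by
    rw [← sum_neg_distrib]
    exact sum_congr rfl fun p hp => hsymm p (Nat.lt_succ_iff.1 (mem_range.1 hp))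
  linarith

/-- **The balanced case** `2uᵢ + vᵢ = N + 1`: the coefficients of the parity of `(n+1)(N+1)` vanish.
[cite: Dupont2018OddZeta, Corollary 5.6 (second claim); CressonFischlerRivoal2008, Théorème 1] -/
theorem exists_coeffs_balanced {n N : ℕ} {u v : Fin n → ℕ} (hn : 1 ≤ n) (hu : ∀ i, 1 ≤ u i)
    (hv : ∀ i, 1 ≤ v i) (hV : N + 1 ≤ ∑ i, v i) (hbal : ∀ i, 2 * u i + v i = N + 1) :
    ∃ a : ℕ → ℚ,
      (cubeIntegral n N u v = a 0 + ∑ k ∈ Icc 2 n, (a k : ℝ) * zetaValue k) ∧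
      (Odd ((n + 1) * (N + 1)) → ∀ k ∈ Icc 2 n, Even k → a k = 0) ∧
      (Even ((n + 1) * (N + 1)) → ∀ k ∈ Icc 2 n, Odd k → a k = 0) := by
  have hN : 2 ≤ N := by
    have := hbal ⟨0, hn⟩; have := hu ⟨0, hn⟩; have := hv ⟨0, hn⟩; omega
  have hL : ∀ i, u i + v i ≤ (N - 2) + 2 := fun i => by have := hbal i; have := hu i; omega
  obtain ⟨c, hc⟩ := exists_pfData (N := N) (L' := N - 2) hn (by omega) hu hL hV
  set Q : ℚ[X] := windowPoly n N (N - 2) u v with hQ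
  set P : ℚ[X] := Q.comp (X - C 1) with hP
  have hPQ : P.comp (X + C 1) = Q := by
    rw [hP, comp_assoc, sub_comp, X_comp, C_comp, add_sub_cancel_right, comp_X]
  have hc' : ∀ t : ℚ, (∀ p, p ≤ N - 2 → t + p + 1 ≠ 0) →
      pfEval (N - 2) n c t = (P.comp (X + C 1)).eval t / poch (t + 1) (N - 2 + 1) ^ n := by
    rw [hPQ]; exact hc
  have hPsym : P.comp (-((N - 2 : ℕ) : ℚ[X]) - X) = C ((-1 : ℚ) ^ (N - 1)) * P := by
    apply Polynomial.funext
    intro t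
    simp only [hP, eval_comp, eval_mul, eval_C, eval_sub, eval_neg, eval_natCast, eval_X]
    have h := windowPoly_reflect hN hu hbal (t - 1)
    rw [show -(N : ℚ) - (t - 1) = -((N - 2 : ℕ) : ℚ) - t - 1 by
      rw [Nat.cast_sub hN]; push_cast; ring] at h
    exact h
  have hk1 : ∀ k ∈ Icc 2 n, k - 1 < n ∧ k ≠ 0 := fun k hk => by
    have := (mem_Icc.1 hk).1; have := (mem_Icc.1 hk).2; omega
  have hm1 : (-1 : ℚ[X]) = C (-1 : ℚ) := by simp
  refine ⟨pfCoeff n (N - 2) c, ?_, ?_, ?_⟩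
  · rw [cubeIntegral_eq_pfSum hn (by omega) hu hv hL hV c hc, pfSum_eq_coeffForm]
  · intro hodd k hk hkev
    have hpar : Even n ∧ Even N := by
      rcases Nat.even_or_odd n with h1 | h1 <;> rcases Nat.even_or_odd N with h2 | h2
      · exact ⟨h1, h2⟩
      · exact absurd hodd (Nat.not_odd_iff_even.2 ((h2.add_one).mul_left _))
      · exact absurd hodd (Nat.not_odd_iff_even.2 ((h1.add_one).mul_right _))
      · exact absurd hodd (Nat.not_odd_iff_even.2 ((h1.add_one).mul_right _))
    have hsym : P.comp (-((N - 2 : ℕ) : ℚ[X]) - X) = (-1 : ℚ[X]) ^ (n * (N - 2 + 1) + 1) * P := by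
      rw [hPsym, hm1, ← C_pow]
      congr 2
      have h1 : Odd (N - 1) := by obtain ⟨k, hk⟩ := hpar.2; exact ⟨k - 1, by omega⟩
      have h2 : Odd (n * (N - 2 + 1) + 1) := (hpar.1.mul_right _).add_one
      rw [h1.neg_one_pow, h2.neg_one_pow]
    have hko : Odd (k - 1) := by
      obtain ⟨r, hr⟩ := hkev; exact ⟨r - 1, by have := (hk1 k hk).2; omega⟩
    have hz := partialFractions_sum_odd_order (N - 2) n P hsym c hc' (k - 1) (hk1 k hk).1 hko
    rw [pfCoeff, if_neg (hk1 k hk).2]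
    exact hz
  · intro heven k hk hkodd
    have hpar : Odd n ∨ Odd N := by
      rcases Nat.even_or_odd n with h1 | h1
      · rcases Nat.even_or_odd N with h2 | h2
        · exact absurd (h1.add_one.mul h2.add_one) (Nat.not_odd_iff_even.2 heven)
        · exact Or.inr h2
      · exact Or.inl h1
    have hsym : P.comp (-((N - 2 : ℕ) : ℚ[X]) - X) = (-1 : ℚ[X]) ^ (n * (N - 2 + 1)) * P := by
      rw [hPsym, hm1, ← C_pow]
      congr 2
      rw [show N - 2 + 1 = N - 1 by omega]
      rcases Nat.even_or_odd (N - 1) with hN1 | hN1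
      · rw [hN1.neg_one_pow, (hN1.mul_left n).neg_one_pow]
      · have hn1 : Odd n := hpar.resolve_right fun hNodd => by
          obtain ⟨k, hk⟩ := hNodd
          exact (Nat.not_even_iff_odd.2 hN1) ⟨k, by omega⟩
        rw [hN1.neg_one_pow, (hn1.mul hN1).neg_one_pow]
    have hke : Even (k - 1) := by obtain ⟨r, hr⟩ := hkodd; exact ⟨r, by omega⟩
    have hz := sum_pf_even_order (N - 2) n P hsym c hc' (k - 1) (hk1 k hk).1 hke
    rw [pfCoeff, if_neg (hk1 k hk).2]
    exact hz

/-! ### Assembly -/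

/-- **Corollary 5.6 of [Dupont2018OddZeta], PROVED** (discharge of the named fact `corollary_5_6`): absolute
convergence, the decomposition `a₀ + a₂ζ(2) + ⋯ + a_nζ(n)` with rational coefficients, and the parity vanishing
in the balanced case `2uᵢ + vᵢ = N + 1`. [cite: Dupont2018OddZeta, Corollary 5.6] -/
theorem corollary_5_6_holds : corollary_5_6 := by
  intro n N u v hn hu hv hV
  refine ⟨integrableOn_cubeIntegrand hn hu hv hV, ?_⟩
  by_cases hbal : ∀ i, 2 * u i + v i = N + 1
  · obtain ⟨a, h1, h2, h3⟩ := exists_coeffs_balanced hn hu hv hV hbal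
    exact ⟨a, h1, fun _ => ⟨h2, h3⟩⟩
  · rcases Nat.eq_zero_or_pos N with hN0 | hNpos
    · subst hN0
      refine ⟨fun k => if k = 0 then cubeTermQ n 0 u v 0 else 0, ?_, fun h => absurd h hbal⟩
      rw [cubeIntegral_level_zero hn hu hv hV]
      have hs : ∑ k ∈ Icc 2 n,
          (((fun k => if k = 0 then cubeTermQ n 0 u v 0 else 0) k : ℚ) : ℝ) * zetaValue k = 0 :=
        sum_eq_zero fun k hk => by
          have hk0 : k ≠ 0 := by have := (mem_Icc.1 hk).1; omega
          simp [hk0]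
      rw [hs]
      simp
    · obtain ⟨a, ha⟩ := exists_coeffs_of_pos hn hNpos hu hv hV
      exact ⟨a, ha, fun h => absurd h hbal⟩

/-! ### The weight drop (Proposition 5.8): no `ζ(n)` when some `uᵢ + vᵢ ≤ N` -/

/-- **Top-order partial-fraction coefficients are residues**: if `c` are partial-fraction data of
`Q(t)/((t+1)_{n'+1})^{K+1}`, then `c_{K,p₀}·∏_{q≠p₀}(q−p₀)^{K+1} = Q(−p₀−1)` (clear denominators: the
polynomial identity holds at all naturals, hence identically; evaluate at the pole).
[cite: CressonFischlerRivoal2008, §4.1 (uniqueness of the partial-fraction expansion); Rivoal2000CRAS, §2] -/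
theorem pf_top_coeff (n' K : ℕ) (c : ℕ → ℕ → ℚ) (Q : ℚ[X])
    (hc : ∀ t : ℚ, (∀ p, p ≤ n' → t + p + 1 ≠ 0) →
      pfEval n' (K + 1) c t = Q.eval t / poch (t + 1) (n' + 1) ^ (K + 1))
    (p₀ : ℕ) (hp₀ : p₀ ≤ n') :
    c K p₀ * ∏ q ∈ (range (n' + 1)).erase p₀, (-(p₀ : ℚ) - 1 + q + 1) ^ (K + 1) =
      Q.eval (-(p₀ : ℚ) - 1) := by
  classical
  set R : ℚ[X] := (∑ p ∈ range (n' + 1), ∑ o ∈ range (K + 1),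
      C (c o p) * ((X + C (p : ℚ) + 1) ^ (K - o) *
        ∏ q ∈ (range (n' + 1)).erase p, (X + C (q : ℚ) + 1) ^ (K + 1))) - Q with hR
  have hReval : ∀ t : ℚ, R.eval t = (∑ p ∈ range (n' + 1), ∑ o ∈ range (K + 1),
      c o p * ((t + p + 1) ^ (K - o) * ∏ q ∈ (range (n' + 1)).erase p, (t + q + 1) ^ (K + 1))) -
        Q.eval t := by
    intro t
    simp only [hR, eval_sub, eval_finsetSum, eval_mul, eval_C, eval_pow, eval_add, eval_X, eval_one,
      eval_prod]
  have hpoch : ∀ t : ℚ, poch (t + 1) (n' + 1) = ∏ q ∈ range (n' + 1), (t + q + 1) := by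
    intro t
    unfold poch
    exact prod_congr rfl fun q _ => by ring
  -- `R` vanishes at every natural number
  have hzero : ∀ t : ℕ, R.eval (t : ℚ) = 0 := by
    intro t
    have hpos : ∀ m : ℕ, (t : ℚ) + m + 1 ≠ 0 := fun m => by positivity
    have hP : ∏ q ∈ range (n' + 1), ((t : ℚ) + q + 1) ^ (K + 1) ≠ 0 :=
      prod_ne_zero_iff.2 fun q _ => pow_ne_zero _ (hpos q)
    have e : (∑ p ∈ range (n' + 1), ∑ o ∈ range (K + 1),
        c o p * (((t : ℚ) + p + 1) ^ (K - o) * ∏ q ∈ (range (n' + 1)).erase p, ((t : ℚ) + q + 1) ^ (K + 1))) =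
        pfEval n' (K + 1) c t * ∏ q ∈ range (n' + 1), ((t : ℚ) + q + 1) ^ (K + 1) := by
      rw [pfEval, sum_mul]
      refine sum_congr rfl fun p hp => ?_
      rw [sum_mul]
      refine sum_congr rfl fun o ho => ?_
      have ho' : o ≤ K := Nat.lt_succ_iff.1 (mem_range.1 ho)
      rw [← mul_prod_erase _ _ hp]
      have hsplit : ((t : ℚ) + p + 1) ^ (K + 1) = ((t : ℚ) + p + 1) ^ (o + 1) * ((t : ℚ) + p + 1) ^ (K - o) := by
        rw [← pow_add]; congr 1; omega
      rw [hsplit]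
      have := hpos p
      field_simp
    rw [hReval, e, hc _ (fun p _ => hpos p), hpoch, ← prod_pow, div_mul_cancel₀ _ hP, sub_self]
  have hR0 : R = 0 := by
    apply Polynomial.eq_zero_of_infinite_isRoot
    apply Set.infinite_of_not_bddAbove
    rintro ⟨B, hB⟩
    set t : ℕ := ⌈B⌉₊ + 1 with ht
    have hroot : (t : ℚ) ∈ {x | R.IsRoot x} := by
      simp only [Set.mem_setOf_eq, IsRoot.def]
      exact hzero t
    have h1 : (t : ℚ) ≤ B := hB hroot
    have h2 : B < t := by
      have : (⌈B⌉₊ : ℚ) + 1 ≤ t := by rw [ht]; push_cast; exact le_rfl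
      linarith [Nat.le_ceil B]
    linarith
  -- evaluate at the pole `-p₀-1`
  have hev : (∑ p ∈ range (n' + 1), ∑ o ∈ range (K + 1),
      c o p * ((-(p₀ : ℚ) - 1 + p + 1) ^ (K - o) *
        ∏ q ∈ (range (n' + 1)).erase p, (-(p₀ : ℚ) - 1 + q + 1) ^ (K + 1))) =
      c K p₀ * ∏ q ∈ (range (n' + 1)).erase p₀, (-(p₀ : ℚ) - 1 + q + 1) ^ (K + 1) := by
    rw [sum_eq_single p₀, sum_eq_single K]
    · have : (-(p₀ : ℚ) - 1 + p₀ + 1) ^ (K - K) = 1 := by simp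
      rw [this, one_mul]
    · intro o ho hne
      have ho' : o < K := lt_of_le_of_ne (Nat.lt_succ_iff.1 (mem_range.1 ho)) hne
      have : (-(p₀ : ℚ) - 1 + p₀ + 1) ^ (K - o) = 0 := by
        rw [show (-(p₀ : ℚ) - 1 + p₀ + 1) = 0 by ring, zero_pow (by omega)]
      rw [this, zero_mul, mul_zero]
    · intro hK
      exact absurd (mem_range.2 (Nat.lt_succ_self K)) hK
    · intro p hp hne
      refine sum_eq_zero fun o _ => ?_
      have hmem : p₀ ∈ (range (n' + 1)).erase p :=
        mem_erase.2 ⟨hne.symm, mem_range.2 (Nat.lt_succ_of_le hp₀)⟩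
      rw [prod_eq_zero hmem (by rw [show (-(p₀ : ℚ) - 1 + p₀ + 1) = 0 by ring, zero_pow (by omega)]),
        mul_zero, mul_zero]
    · intro hp
      exact absurd (mem_range.2 (Nat.lt_succ_of_le hp₀)) hp
  have h := hReval (-(p₀ : ℚ) - 1)
  rw [hR0, eval_zero, hev] at h
  linarith

/-- Under the weight-drop hypothesis `∃ i, uᵢ + vᵢ ≤ N` the window polynomial vanishes at every pole
`t = −j`, `1 ≤ j ≤ L'+1`: for `j ≤ N − 1` the binomial block `(t+1)_{N−1}` vanishes, for `j ≥ N` the tail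
block `(t+uᵢ+vᵢ)_{L'+2−uᵢ−vᵢ}` of that `i` does. [cite: Dupont2018OddZeta, Proposition 5.8 (proof: "a careful
analysis of the degree … vanishing of more highest weight coefficients")] -/
theorem windowPoly_eval_neg_eq_zero {n N L' : ℕ} {u v : Fin n → ℕ}
    (hdrop : ∃ i, u i + v i ≤ N) {j : ℕ} (hj1 : 1 ≤ j) (hj2 : j ≤ L' + 1) :
    (windowPoly n N L' u v).eval (-(j : ℚ)) = 0 := by
  rw [windowPoly_eval]
  rcases Nat.lt_or_ge j N with hjN | hjN
  · -- the binomial block vanishes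
    have hB : poch (-(j : ℚ) + 1) (N - 1) = 0 := by
      unfold poch
      exact prod_eq_zero (mem_range.2 (by omega : j - 1 < N - 1))
        (by rw [Nat.cast_sub hj1]; push_cast; ring)
    rw [hB, mul_zero, zero_mul]
  · obtain ⟨i, hi⟩ := hdrop
    have hT : poch (-(j : ℚ) + ((u i : ℚ) + v i)) (L' + 2 - (u i + v i)) = 0 := by
      unfold poch
      refine prod_eq_zero (mem_range.2 (by omega : j - (u i + v i) < L' + 2 - (u i + v i))) ?_
      rw [Nat.cast_sub (by omega : u i + v i ≤ j)]; push_cast; ring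
    have hP : ∏ i, (poch (-(j : ℚ) + 1) (u i - 1) *
        poch (-(j : ℚ) + ((u i : ℚ) + v i)) (L' + 2 - (u i + v i))) = 0 :=
      prod_eq_zero (mem_univ i) (by rw [hT, mul_zero])
    rw [hP, mul_zero]

/-- **Proposition 5.8 of [Dupont2018OddZeta] (the weight drop), PROVED**: if `uᵢ, vᵢ ≥ 1`, `Σvᵢ ≥ N+1`
and `uᵢ + vᵢ ≤ N` for some `i`, the cube integral is `a₀ + a₂ζ(2) + ⋯ + a_{n−1}ζ(n−1)` with rational `a_k`
(no `ζ(n)`): every top-order partial-fraction coefficient is a residue of the window polynomial at a pole,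
where it vanishes. [cite: Dupont2018OddZeta, Proposition 5.8] -/
theorem proposition_5_8 (n N : ℕ) (u v : Fin n → ℕ) (hn : 1 ≤ n) (hu : ∀ i, 1 ≤ u i)
    (hv : ∀ i, 1 ≤ v i) (hV : N + 1 ≤ ∑ i, v i) (hdrop : ∃ i, u i + v i ≤ N) :
    ∃ a : ℕ → ℚ, cubeIntegral n N u v = a 0 + ∑ k ∈ Icc 2 (n - 1), (a k : ℝ) * zetaValue k := by
  have hN : 1 ≤ N := by obtain ⟨i, hi⟩ := hdrop; have := hu i; have := hv i; omega
  have hL : ∀ i, u i + v i ≤ (∑ j, (u j + v j)) + 2 := fun i =>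
    (single_le_sum (f := fun j => u j + v j) (fun j _ => Nat.zero_le _) (mem_univ i)).trans
      (Nat.le_add_right _ _)
  set L' := ∑ j, (u j + v j) with hL'
  obtain ⟨c, hc⟩ := exists_pfData hn hN hu hL hV
  have heq := cubeIntegral_eq_pfSum hn hN hu hv hL hV c hc
  rw [pfSum_eq_coeffForm] at heq
  obtain ⟨K, hK⟩ : ∃ K, n = K + 1 := ⟨n - 1, by omega⟩
  have htop : ∀ p, p ≤ L' → c K p = 0 := by
    intro p hp
    have hc' : ∀ t : ℚ, (∀ q, q ≤ L' → t + q + 1 ≠ 0) →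
        pfEval L' (K + 1) c t = (windowPoly n N L' u v).eval t / poch (t + 1) (L' + 1) ^ (K + 1) := by
      rw [← hK]; exact hc
    have h := pf_top_coeff L' K c _ hc' p hp
    have hQ0 : (windowPoly n N L' u v).eval (-(p : ℚ) - 1) = 0 := by
      rw [show (-(p : ℚ) - 1) = -((p + 1 : ℕ) : ℚ) by push_cast; ring]
      exact windowPoly_eval_neg_eq_zero hdrop (by omega) (by omega)
    rw [hQ0] at h
    have hprod : ∏ q ∈ (range (L' + 1)).erase p, (-(p : ℚ) - 1 + q + 1) ^ (K + 1) ≠ 0 := by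
      refine prod_ne_zero_iff.2 fun q hq => pow_ne_zero _ ?_
      have hne : q ≠ p := (mem_erase.1 hq).1
      intro h0
      apply hne
      exact_mod_cast (by linarith : (q : ℚ) = p)
    exact (mul_eq_zero.1 h).resolve_right hprod
  have han : pfCoeff n L' c n = 0 := by
    rw [pfCoeff, if_neg (by omega : n ≠ 0), show n - 1 = K by omega]
    exact sum_eq_zero fun p hp => htop p (Nat.lt_succ_iff.1 (mem_range.1 hp))
  refine ⟨pfCoeff n L' c, ?_⟩
  rw [heq]
  rcases Nat.lt_or_ge n 2 with h1 | h2
  · rw [Finset.Icc_eq_empty_of_lt (by omega : n < 2), Finset.Icc_eq_empty_of_lt (by omega : n - 1 < 2)]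
  · obtain ⟨m, rfl⟩ : ∃ m, n = m + 1 := ⟨n - 1, by omega⟩
    rw [Finset.sum_Icc_succ_top (by omega : 2 ≤ m + 1), han, Nat.add_sub_cancel]
    simp

end Literature.NumberTheory.Irrationality.Dupont2018
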